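import Mathlib
import HarnessLib
import Summits.CriticalPhenomena.SAWScalingLimit.Theorems.SAWLoopLiftWernerDeterminationTopology
import Summits.CriticalPhenomena.SAWScalingLimit.Theorems.SAWLoopLiftWernerDeterminationHyperspace

/-!
# Werner determination (route SAWLoopLift, item stmt-CriticalPhenomena-4851) — the surrounding events
generate the hyperspace σ-algebra on simple loops

Helper file (`--supports stmt-CriticalPhenomena-4851`). Fix a point `q`. Werner (arXiv:math/0511605, p. 9)
remarks that the events "the loop stays in `W` and surrounds `q`" generate the Borel σ-field of the
Hausdorff metric restricted to simple loops surrounding `q`. We prove the form needed for the uniqueness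
theorem of `Literature.MeasureTheory.RandomSets.AvoidanceFunctional`: for every OPEN `U ⊆ ℂ` there is a
set `A`, measurable for the σ-algebra generated by the π-system `piSys q` (events over open sets without
holes), such that the MISS EVENT `{T | T ∩ U = ∅}` and `A` have the same trace on the compact sets `T`
which surround `q` and satisfy the two conclusions of the Jordan curve theorem used here:

* (J1) every point off `T` lies in the component of `q` or in an unbounded component of `Tᶜ`;
* (J2) `T` lies in the closure of its exterior `{w ∉ T | cc(Tᶜ, w) unbounded}`

(simple loops surrounding `q` have both properties; that is checked in the main file). The steps:
exterior points (`measurableSet_generateFrom_exterior`), open sets inside the component of `q` (a dense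
sequence and (J1), (J2)), compact connected sets through `q` missed by `T` (thickenings), compact connected
sets inside the component of `q` (`exists_countable_setOf_interior_eq`), closed discs missed by `T`
((J1): a missed connected set is inside or outside), open sets missed by `T` (countably many closed discs).

No new definitions. References: W. Werner, J. Amer. Math. Soc. 21 (2008), §3, p. 9; I. Molchanov,
*Theory of Random Sets* (2005), §1.6.
-/

noncomputable section

namespace Summit.CriticalPhenomena.SAWScalingLimit.Theorems.WernerDetermination

open Set Metric Bornology Topology Filter TopologicalSpace MeasureTheory

/-- The event "`T ⊆ W` and `T` surrounds `z`" of the route item (local notation). -/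
local notation3 "around " z " inW " W => {T : NonemptyCompacts ℂ | (T : Set ℂ) ⊆ W ∧ z ∉ (T : Set ℂ) ∧
  IsBounded (connectedComponentIn (T : Set ℂ)ᶜ z)}

/-- The π-system of such events over open sets `W` without holes (local notation). -/
local notation3 "piSys " z => {S : Set (NonemptyCompacts ℂ) | ∃ W : Set ℂ, IsOpen W ∧
  (∀ a ∈ Wᶜ, ¬ IsBounded (connectedComponentIn Wᶜ a)) ∧ S = around z inW W}

/-- The compact set `T` surrounds `q` and satisfies the two consequences (J1), (J2) of the Jordan curve
theorem (local notation). -/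
local notation3 "IsGood " q " at " T => (q ∉ (T : Set ℂ) ∧ IsBounded (connectedComponentIn (T : Set ℂ)ᶜ q)) ∧
  (∀ w : ℂ, w ∉ (T : Set ℂ) → w ∈ connectedComponentIn (T : Set ℂ)ᶜ q ∨
    ¬ IsBounded (connectedComponentIn (T : Set ℂ)ᶜ w)) ∧
  (T : Set ℂ) ⊆ closure {w : ℂ | w ∉ (T : Set ℂ) ∧ ¬ IsBounded (connectedComponentIn (T : Set ℂ)ᶜ w)}

/-! ### The exterior of a closed set is open -/

/-- The exterior `{w ∉ T | cc(Tᶜ, w) unbounded}` of a closed set is open (it is a union of components of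
the open set `Tᶜ`). [folklore] -/
theorem isOpen_setOf_not_isBounded_plane {T : Set ℂ} (hT : IsClosed T) :
    IsOpen {w : ℂ | w ∉ T ∧ ¬ IsBounded (connectedComponentIn Tᶜ w)} := by
  refine isOpen_iff_mem_nhds.2 fun w ⟨hwT, hwb⟩ => ?_
  refine mem_of_superset (hT.isOpen_compl.connectedComponentIn.mem_nhds (mem_connectedComponentIn hwT)) ?_
  intro w' hw'
  refine ⟨connectedComponentIn_subset _ _ hw', ?_⟩
  rwa [← connectedComponentIn_eq hw']

/-! ### Step 1: exterior points -/

/-- **Exterior points.** The event "`T` surrounds `q` and `d` is an exterior point of `T`" is measurable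
for the generated σ-algebra (`measurableSet_generateFrom_exterior` with `Q = {d}`). [folklore] -/
theorem measurableSet_generateFrom_exterior_singleton (q d : ℂ) :
    MeasurableSet[MeasurableSpace.generateFrom (piSys q)]
      {T : NonemptyCompacts ℂ | (q ∉ (T : Set ℂ) ∧ IsBounded (connectedComponentIn (T : Set ℂ)ᶜ q)) ∧
        (d ∉ (T : Set ℂ) ∧ ¬ IsBounded (connectedComponentIn (T : Set ℂ)ᶜ d))} := by
  have h := measurableSet_generateFrom_exterior q (isCompact_singleton (x := d))
    (Set.subsingleton_singleton.isPreconnected) (singleton_nonempty d)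
  convert h using 2 with T
  simp only [mem_singleton_iff, forall_eq]

/-! ### Step 2: open sets inside the component of `q` -/

/-- **Open sets inside the component of `q`.** For an open `G` there is a set `A`, measurable for the
generated σ-algebra, whose trace on good `T` is the event `G ⊆ cc(Tᶜ, q)`: with a countable dense `D`,
`A = {T surrounds q} ∩ ⋂_{d ∈ D ∩ G} {d is not exterior}`; for a good `T` in `A`, `G` misses the (open)
exterior (density), hence misses `T` (J2), hence lies in the component of `q` (J1). [folklore] -/
theorem exists_measurableSet_generateFrom_subset_cc (q : ℂ) {G : Set ℂ} (hG : IsOpen G) :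
    ∃ A : Set (NonemptyCompacts ℂ), MeasurableSet[MeasurableSpace.generateFrom (piSys q)] A ∧
      ∀ T : NonemptyCompacts ℂ, (IsGood q at T) → (G ⊆ connectedComponentIn (T : Set ℂ)ᶜ q ↔ T ∈ A) := by
  obtain ⟨D, hDc, hDd⟩ := TopologicalSpace.exists_countable_dense ℂ
  refine ⟨(around q inW univ) ∩ ⋂ d ∈ {d ∈ D | d ∈ G},
    {T : NonemptyCompacts ℂ | (q ∉ (T : Set ℂ) ∧ IsBounded (connectedComponentIn (T : Set ℂ)ᶜ q)) ∧
      (d ∉ (T : Set ℂ) ∧ ¬ IsBounded (connectedComponentIn (T : Set ℂ)ᶜ d))}ᶜ, ?_, ?_⟩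
  · refine (measurableSet_generateFrom_around q isOpen_univ (by simp)).inter ?_
    exact MeasurableSet.biInter (hDc.mono (sep_subset _ _)) fun d _ =>
      (measurableSet_generateFrom_exterior_singleton q d).compl
  · rintro T ⟨⟨hq, hqb⟩, hJ1, hJ2⟩
    simp only [mem_inter_iff, mem_setOf_eq, subset_univ, true_and, mem_iInter, mem_compl_iff, not_and,
      not_not]
    constructor
    · intro hGq
      refine ⟨⟨hq, hqb⟩, fun d ⟨_, hdG⟩ _ _ => ?_⟩
      rw [← connectedComponentIn_eq (hGq hdG)]
      exact hqb
    · rintro ⟨-, hD⟩ g hg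
      -- the open set `G` misses the exterior of `T`
      have hGext : ∀ e ∈ G, ¬ (e ∉ (T : Set ℂ) ∧ ¬ IsBounded (connectedComponentIn (T : Set ℂ)ᶜ e)) := by
        intro e heG he
        obtain ⟨d, ⟨hdG, hde⟩, hdD⟩ := hDd.inter_open_nonempty _
          (hG.inter (isOpen_setOf_not_isBounded_plane T.isCompact.isClosed)) ⟨e, heG, he⟩
        exact hde.2 (hD d ⟨hdD, hdG⟩ ⟨hq, hqb⟩ hde.1)
      -- hence misses `T` (J2)
      have hgT : g ∉ (T : Set ℂ) := by
        intro hgT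
        obtain ⟨e, heG, he⟩ := mem_closure_iff.1 (hJ2 hgT) G hG hg
        exact hGext e heG he
      -- hence lies in the component of `q` (J1)
      rcases hJ1 g hgT with h | h
      · exact h
      · exact absurd ⟨hgT, h⟩ (hGext g hg)

/-! ### Step 3: compact connected sets through `q` missed by `T` -/

/-- **Compact connected sets through `q` missed by `T`.** For `K` compact, preconnected with `q ∈ K` there
is a set `A`, measurable for the generated σ-algebra, whose trace on good `T` is the miss event
`T ∩ K = ∅`: a good `T` misses `K` iff `K ⊆ cc(Tᶜ, q)` iff some `1/(n+1)`-thickening of `K` lies in the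
(open) component; apply Step 2 to the thickenings. [folklore] -/
theorem exists_measurableSet_generateFrom_disjoint_of_mem (q : ℂ) {K : Set ℂ} (hK : IsCompact K)
    (hKp : IsPreconnected K) (hqK : q ∈ K) :
    ∃ A : Set (NonemptyCompacts ℂ), MeasurableSet[MeasurableSpace.generateFrom (piSys q)] A ∧
      ∀ T : NonemptyCompacts ℂ, (IsGood q at T) → (Disjoint (T : Set ℂ) K ↔ T ∈ A) := by
  choose A hAm hA using fun n : ℕ =>
    exists_measurableSet_generateFrom_subset_cc q (isOpen_thickening (δ := 1 / ((n : ℝ) + 1)) (E := K))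
  refine ⟨⋃ n, A n, MeasurableSet.iUnion hAm, fun T hT => ?_⟩
  have hopen : IsOpen (connectedComponentIn (T : Set ℂ)ᶜ q) :=
    T.isCompact.isClosed.isOpen_compl.connectedComponentIn
  rw [mem_iUnion]
  constructor
  · intro hTK
    have hKq : K ⊆ connectedComponentIn (T : Set ℂ)ᶜ q :=
      hKp.subset_connectedComponentIn hqK (fun x hxK hxT => disjoint_left.1 hTK hxT hxK)
    obtain ⟨δ, hδ, hδK⟩ := hK.exists_thickening_subset_open hopen hKq
    obtain ⟨n, hn⟩ := exists_nat_one_div_lt hδ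
    refine ⟨n, (hA n T hT).1 ((thickening_mono hn.le K).trans hδK)⟩
  · rintro ⟨n, hn⟩
    have hKq : K ⊆ connectedComponentIn (T : Set ℂ)ᶜ q :=
      (self_subset_thickening (by positivity) K).trans ((hA n T hT).2 hn)
    exact disjoint_left.2 fun x hxT hxK => connectedComponentIn_subset _ _ (hKq hxK) hxT

/-! ### Step 4: compact connected sets inside the component of `q` -/

/-- **Compact connected sets inside the component of `q`.** For `Q` compact, preconnected, nonempty there is
a set `A`, measurable for the generated σ-algebra, whose trace on good `T` is the event `Q ⊆ cc(Tᶜ, q)`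
(countably many miss events of compact connected `K ∋ q`, `exists_countable_setOf_interior_eq`, and Step 3).
[folklore] -/
theorem exists_measurableSet_generateFrom_subset_cc_of_isCompact (q : ℂ) {Q : Set ℂ} (hQ : IsCompact Q)
    (hQp : IsPreconnected Q) (hQne : Q.Nonempty) :
    ∃ A : Set (NonemptyCompacts ℂ), MeasurableSet[MeasurableSpace.generateFrom (piSys q)] A ∧
      ∀ T : NonemptyCompacts ℂ, (IsGood q at T) → (Q ⊆ connectedComponentIn (T : Set ℂ)ᶜ q ↔ T ∈ A) := by
  obtain ⟨C, hCc, hC𝒦, hCeq⟩ := exists_countable_setOf_interior_eq q hQ hQp hQne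
  have hA : ∀ K : C, ∃ A : Set (NonemptyCompacts ℂ), MeasurableSet[MeasurableSpace.generateFrom (piSys q)] A ∧
      ∀ T : NonemptyCompacts ℂ, (IsGood q at T) → (Disjoint (T : Set ℂ) K ↔ T ∈ A) := fun K =>
    exists_measurableSet_generateFrom_disjoint_of_mem q (hC𝒦 K.2).1 (hC𝒦 K.2).2.1 (hC𝒦 K.2).2.2.1
  choose A hAm hA using hA
  haveI : Countable C := hCc.to_subtype
  refine ⟨⋃ K : C, A K, MeasurableSet.iUnion hAm, fun T hT => ?_⟩
  have key : Q ⊆ connectedComponentIn (T : Set ℂ)ᶜ q ↔ T ∈ {T : NonemptyCompacts ℂ |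
      (q ∉ (T : Set ℂ) ∧ IsBounded (connectedComponentIn (T : Set ℂ)ᶜ q)) ∧
        Q ⊆ connectedComponentIn (T : Set ℂ)ᶜ q} :=
    ⟨fun h => ⟨hT.1, h⟩, fun h => h.2⟩
  rw [key, hCeq]
  simp only [mem_iUnion, mem_setOf_eq, exists_prop]
  constructor
  · rintro ⟨K, hKC, -, hTK⟩
    exact ⟨⟨K, hKC⟩, (hA ⟨K, hKC⟩ T hT).1 hTK⟩
  · rintro ⟨K, hTK⟩
    exact ⟨K, K.2, hT.1, (hA K T hT).2 hTK⟩

/-! ### Step 5: closed connected sets missed by `T` -/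

/-- **A missed connected set is inside or outside** (J1): a good `T` misses the compact preconnected
nonempty `Q` iff `Q` lies in the exterior of `T` or in the component of `q`. [folklore] -/
theorem disjoint_iff_exterior_or_subset_cc {q : ℂ} {T : NonemptyCompacts ℂ} (hT : IsGood q at T)
    {Q : Set ℂ} (hQp : IsPreconnected Q) (hQne : Q.Nonempty) :
    Disjoint (T : Set ℂ) Q ↔ (∀ x ∈ Q, x ∉ (T : Set ℂ) ∧ ¬ IsBounded (connectedComponentIn (T : Set ℂ)ᶜ x)) ∨
      Q ⊆ connectedComponentIn (T : Set ℂ)ᶜ q := by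
  obtain ⟨-, hJ1, -⟩ := hT
  constructor
  · intro hTQ
    obtain ⟨q₀, hq₀⟩ := hQne
    have hQT : ∀ x ∈ Q, x ∉ (T : Set ℂ) := fun x hx hxT => disjoint_left.1 hTQ hxT hx
    have hQc : Q ⊆ connectedComponentIn (T : Set ℂ)ᶜ q₀ :=
      hQp.subset_connectedComponentIn hq₀ fun x hx => hQT x hx
    rcases hJ1 q₀ (hQT q₀ hq₀) with h | h
    · right
      rwa [connectedComponentIn_eq h, ← connectedComponentIn_eq (mem_connectedComponentIn (hQT q₀ hq₀))]
    · left
      intro x hx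
      refine ⟨hQT x hx, ?_⟩
      rwa [← connectedComponentIn_eq (hQc hx)]
  · rintro (h | h)
    · exact disjoint_left.2 fun x hxT hxQ => (h x hxQ).1 hxT
    · exact disjoint_left.2 fun x hxT hxQ => connectedComponentIn_subset _ _ (h hxQ) hxT

/-- **Compact connected sets missed by `T`.** For `Q` compact, preconnected, nonempty there is a set `A`,
measurable for the generated σ-algebra, whose trace on good `T` is the miss event `T ∩ Q = ∅` (Steps 1
and 4 via `disjoint_iff_exterior_or_subset_cc`). [folklore] -/
theorem exists_measurableSet_generateFrom_disjoint (q : ℂ) {Q : Set ℂ} (hQ : IsCompact Q)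
    (hQp : IsPreconnected Q) (hQne : Q.Nonempty) :
    ∃ A : Set (NonemptyCompacts ℂ), MeasurableSet[MeasurableSpace.generateFrom (piSys q)] A ∧
      ∀ T : NonemptyCompacts ℂ, (IsGood q at T) → (Disjoint (T : Set ℂ) Q ↔ T ∈ A) := by
  obtain ⟨A, hAm, hA⟩ := exists_measurableSet_generateFrom_subset_cc_of_isCompact q hQ hQp hQne
  refine ⟨{T : NonemptyCompacts ℂ | (q ∉ (T : Set ℂ) ∧ IsBounded (connectedComponentIn (T : Set ℂ)ᶜ q)) ∧
      ∀ x ∈ Q, x ∉ (T : Set ℂ) ∧ ¬ IsBounded (connectedComponentIn (T : Set ℂ)ᶜ x)} ∪ A,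
    (measurableSet_generateFrom_exterior q hQ hQp hQne).union hAm, fun T hT => ?_⟩
  rw [disjoint_iff_exterior_or_subset_cc hT hQp hQne, mem_union, mem_setOf_eq, hA T hT]
  constructor
  · rintro (h | h)
    · exact Or.inl ⟨hT.1, h⟩
    · exact Or.inr h
  · rintro (h | h)
    · exact Or.inl h.2
    · exact Or.inr h

/-! ### Step 6: open sets missed by `T` -/

/-- Every point of an open set `U` lies in a closed disc inside `U` with centre in a given dense set and
rational radius. [folklore] -/
theorem exists_mem_closedBall_subset {D : Set ℂ} (hD : Dense D) {U : Set ℂ} (hU : IsOpen U) {x : ℂ}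
    (hx : x ∈ U) : ∃ d ∈ D, ∃ ρ : ℚ, (0 : ℝ) < ρ ∧ closedBall d (ρ : ℝ) ⊆ U ∧ x ∈ closedBall d (ρ : ℝ) := by
  obtain ⟨ε, hε, hεU⟩ := Metric.isOpen_iff.1 hU x hx
  obtain ⟨d, hdD, hxd⟩ := hD.exists_dist_lt x (by positivity : (0 : ℝ) < ε / 3)
  obtain ⟨ρ, hρ1, hρ2⟩ := exists_rat_btwn (by linarith : ε / 3 < 2 * ε / 3)
  refine ⟨d, hdD, ρ, by linarith, fun y hy => hεU ?_, ?_⟩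
  · rw [mem_closedBall] at hy
    rw [mem_ball]
    calc dist y x ≤ dist y d + dist d x := dist_triangle _ _ _
      _ < ε := by rw [dist_comm d x]; linarith
  · rw [mem_closedBall]
    linarith

/-- **Open sets missed by `T`** (the miss events of the avoidance functional). For every open `U ⊆ ℂ`
there is a set `A`, measurable for the σ-algebra generated by the π-system `piSys q`, such that for every
compact `T` surrounding `q` with (J1) and (J2): `T ∩ U = ∅ ↔ T ∈ A`. (`U` is a countable union of closed
discs; Step 5.) [folklore] -/
theorem exists_measurableSet_generateFrom_disjoint_of_isOpen (q : ℂ) {U : Set ℂ} (hU : IsOpen U) :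
    ∃ A : Set (NonemptyCompacts ℂ), MeasurableSet[MeasurableSpace.generateFrom (piSys q)] A ∧
      ∀ T : NonemptyCompacts ℂ, (IsGood q at T) → (Disjoint (T : Set ℂ) U ↔ T ∈ A) := by
  obtain ⟨D, hDc, hDd⟩ := TopologicalSpace.exists_countable_dense ℂ
  set I : Set (ℂ × ℚ) := {p : ℂ × ℚ | p.1 ∈ D ∧ (0 : ℝ) < p.2 ∧ closedBall p.1 (p.2 : ℝ) ⊆ U} with hI
  have hIc : I.Countable :=
    (hDc.prod (Set.countable_univ : (univ : Set ℚ).Countable)).mono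
      fun p (hp : p ∈ I) => Set.mem_prod.2 ⟨hp.1, mem_univ _⟩
  have hA : ∀ p : I, ∃ A : Set (NonemptyCompacts ℂ), MeasurableSet[MeasurableSpace.generateFrom (piSys q)] A ∧
      ∀ T : NonemptyCompacts ℂ, (IsGood q at T) →
        (Disjoint (T : Set ℂ) (closedBall (p : ℂ × ℚ).1 ((p : ℂ × ℚ).2 : ℝ)) ↔ T ∈ A) := fun p =>
    exists_measurableSet_generateFrom_disjoint q (isCompact_closedBall _ _)
      (convex_closedBall _ _).isPreconnected (nonempty_closedBall.2 p.2.2.1.le)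
  choose A hAm hA using hA
  haveI : Countable I := hIc.to_subtype
  refine ⟨⋂ p : I, A p, MeasurableSet.iInter hAm, fun T hT => ?_⟩
  rw [mem_iInter]
  constructor
  · intro hTU p
    exact (hA p T hT).1 (hTU.mono_right p.2.2.2)
  · intro h
    rw [disjoint_left]
    intro x hxT hxU
    obtain ⟨d, hdD, ρ, hρ, hρU, hxρ⟩ := exists_mem_closedBall_subset hDd hU hxU
    have hp : (d, ρ) ∈ I := ⟨hdD, hρ, hρU⟩
    exact disjoint_left.1 ((hA ⟨(d, ρ), hp⟩ T hT).2 (h ⟨(d, ρ), hp⟩)) hxT hxρ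

end Summit.CriticalPhenomena.SAWScalingLimit.Theorems.WernerDetermination
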